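import Literature.MathematicalPhysics.KineticTheory.DiPernaLionsVelocityAverages
import Literature.MathematicalPhysics.KineticTheory.DiPernaLionsRenormalisedCompactness
import Literature.MathematicalPhysics.KineticTheory.DiPernaLionsSmoothTruncation
import HarnessLib

/-!
# Strong convergence of the velocity averages of the renormalised truncations (CIP L. 5.3.9, Cor.)

Topic: MathematicalPhysics / KineticTheory. Infrastructure for the named fact (L12)
`diPernaLions_limit_expDuhamel` (Cercignani–Illner–Pulvirenti 1994 §5.3 Lemma 5.3.12),
granted the velocity-averaging lemma `velocityAverage_relativelyCompact_L1` (CIP Lemma 5.3.9;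
meanwhile proved, `velocityAverage_relativelyCompact_L1_holds` of `VelocityAveragingProofs`), which
enters as the explicit hypothesis `h9` so that this file stays light. In the supersolution half of the proof of Lemma
5.3.12 (p. 158) CIP apply Lemma 5.3.9 to the truncations: "For every fixed `m`, `{gₘⁿ}` satisfies
the hypotheses of Lemma 5.3.9 ... Therefore, and by arguments similar to those used in Step 12,
`Q₊ⁿ(gₘⁿ,gₘⁿ) ⇀ Q₊(gₘ,gₘ)`". The input from Lemma 5.3.9 used there (after the collision change of
variables of Step 12, `DiPernaLionsGainWeakForm`) is the *strong* `L¹((0,T) × E)` convergence of the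
velocity averages `∫ gₘⁿ ψ dξ` against fixed bounded weights `ψ`, which this file proves for the
smooth truncations `gₘⁿ = χ(v) βₘ(fⁿ)`, `βₘ = expTrunc m` (`DiPernaLionsSmoothTruncation`), with a
bounded measurable velocity cut-off `χ`: the sequence satisfies the hypotheses of Lemma 5.3.9
(`DiPernaLionsCharacteristicsTransport`, `DiPernaLionsRenormalisedCompactness`), hence its
velocity averages are relatively compact in `L¹((0,T) × E)`, and their weak limit is `∫ G ψ dξ`
when `gₘⁿ ⇀ G` (`tendstoWeaklyL1_velocityIntegral` of `DiPernaLionsVelocityAverages`); a relatively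
compact sequence with a unique cluster point converges. Everything is proved; theorems only.

* `TendstoWeaklyL1.mul_fixed`: weak `L¹` convergence is preserved by a fixed bounded multiplier.
* `tendsto_integral_abs_sub_of_relativelyCompact_of_tendstoWeaklyL1`: the subsequence principle.
* `tendsto_integral_abs_velocityIntegral_expTrunc_sub` (**Corollary to Lemma 5.3.9 for the
  renormalised truncations**, granted `h9`).

## References

* C. Cercignani, R. Illner, M. Pulvirenti, *The Mathematical Theory of Dilute Gases*, Springer
  (1994), §5.3 Lemma 5.3.9 and Corollary (p. 154), proof of Lemma 5.3.12 (p. 158).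
-/

open MeasureTheory Metric Real Set Filter Topology
open scoped InnerProductSpace ENNReal NNReal

noncomputable section

namespace Literature.MathematicalPhysics.KineticTheory

open Literature.Analysis.FluidPDE Literature.Analysis.FunctionSpaces

/-! ## Two generic lemmas -/

section Generic

variable {α : Type*} [MeasurableSpace α] {μ : Measure α}

/-- **Weak `L¹` convergence is preserved by a fixed bounded multiplier**: `uₖ ⇀ U` gives
`uₖ ψ ⇀ U ψ` for `ψ` a.e.-strongly measurable with `|ψ| ≤ M` a.e. [folklore] -/
theorem _root_.Literature.Analysis.FunctionSpaces.TendstoWeaklyL1.mul_fixed {u : ℕ → α → ℝ}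
    {U : α → ℝ} (hw : TendstoWeaklyL1 u U μ) {ψ : α → ℝ} (hψ : AEStronglyMeasurable ψ μ) {M : ℝ}
    (hM : ∀ᵐ x ∂μ, |ψ x| ≤ M) :
    TendstoWeaklyL1 (fun k x => u k x * ψ x) (fun x => U x * ψ x) μ := by
  intro φ C hφ hC
  have h := hw (fun x => ψ x * φ x) (M * max C 0) (hψ.mul hφ) (by
    filter_upwards [hM, hC] with x hx hx'
    rw [abs_mul]
    exact mul_le_mul hx (hx'.trans (le_max_left _ _)) (abs_nonneg _)
      ((abs_nonneg _).trans hx))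
  simpa only [mul_assoc] using h

/-- **Subsequence principle for `L¹` convergence with an identified weak limit**: if every
subsequence of `(uₖ)` has a further subsequence converging in `L¹(μ)` to *some* integrable
function, and `uₖ ⇀ v` weakly in `L¹(μ)` (integrable sequence and limit, `σ`-finite `μ`), then
`∫ |uₖ - v| dμ → 0`. [folklore] -/
theorem tendsto_integral_abs_sub_of_relativelyCompact_of_tendstoWeaklyL1 [SigmaFinite μ]
    {u : ℕ → α → ℝ} {v : α → ℝ} (hui : ∀ k, Integrable (u k) μ) (hvi : Integrable v μ)
    (hw : TendstoWeaklyL1 u v μ)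
    (hrc : ∀ φ : ℕ → ℕ, StrictMono φ → ∃ φ' : ℕ → ℕ, StrictMono φ' ∧ ∃ ρ : α → ℝ,
      Integrable ρ μ ∧ Tendsto (fun i => ∫ x, |u (φ (φ' i)) x - ρ x| ∂μ) atTop (𝓝 0)) :
    Tendsto (fun k => ∫ x, |u k x - v x| ∂μ) atTop (𝓝 0) := by
  refine tendsto_of_subseq_tendsto fun ns hns => ?_
  obtain ⟨φ₁, hφ₁, hnsφ₁⟩ := strictMono_subseq_of_tendsto_atTop hns
  obtain ⟨φ', hφ', ρ, hρ, hconv⟩ := hrc (ns ∘ φ₁) hnsφ₁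
  refine ⟨φ₁ ∘ φ', ?_⟩
  have hw1 : TendstoWeaklyL1 (fun i => u ((ns ∘ φ₁) (φ' i))) ρ μ :=
    TendstoWeaklyL1.of_tendsto_integral_abs_sub (fun i => hui _) hρ hconv
  have hw2 : TendstoWeaklyL1 (fun i => u ((ns ∘ φ₁) (φ' i))) v μ := by
    have := hw.comp_strictMono (hnsφ₁.comp hφ')
    simpa [Function.comp_def] using this
  have hρv : ρ =ᵐ[μ] v := hw1.ae_eq hw2 hρ hvi
  refine hconv.congr fun i => integral_congr_ae (hρv.mono fun x hx => ?_)
  simp only [Function.comp_apply]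
  rw [hx]

end Generic

/-! ## Velocity averages of the renormalised truncations -/

universe u

variable {E : Type u} [NormedAddCommGroup E] [InnerProductSpace ℝ E] [FiniteDimensional ℝ E]
  [MeasurableSpace E] [BorelSpace E]

variable {B : E × E → sphere (0 : E) 1 → ℝ} {f₀ : E → E → ℝ} {δ : ℕ → ℝ}
  {Bseq : ℕ → E × E → sphere (0 : E) 1 → ℝ} {fseq : ℕ → ℝ → E → E → ℝ}

/-- **Strong `L¹` convergence of the velocity averages of the renormalised truncations**
(Corollary to CIP 1994 Lemma 5.3.9, p. 154, as used in the proof of Lemma 5.3.12, p. 158: "For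
every fixed `m`, `{gₘⁿ}` satisfies the hypotheses of Lemma 5.3.9"), granted
`velocityAverage_relativelyCompact_L1`. In the setting of `diPernaLions_extraction`, along any
`θ : ℕ → ℕ`: if `χ(v) βₘ(f^{θ(k)}) ⇀ G` weakly in `L¹((0,T) × E × E)` (`βₘ = expTrunc m`, `m > 0`;
`χ` measurable, `|χ| ≤ 1`; `G` integrable on the slab), then for every bounded measurable weight
`ψ`, `∫ |∫ χ βₘ(f^{θ(k)}) ψ dξ - ∫ G ψ dξ| d(t,x) → 0` on `(0,T) × E`. [cite: CIPDiluteGases1994, §5.3 Lemma 5.3.9, Corollary (p. 154) and proof of Lemma 5.3.12 (p. 158)] -/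
theorem tendsto_integral_abs_velocityIntegral_expTrunc_sub
    (h9 : velocityAverage_relativelyCompact_L1.{u})
    (hB : IsDiPernaLionsKernel B) (hf₀ : HasDiPernaLionsData f₀) (hδ : ∀ n, 0 < δ n)
    (hanti : Antitone δ) (hlim : Tendsto δ atTop (𝓝 0))
    (hker : IsDiPernaLionsKernelApproximation B Bseq)
    (hdata : IsDiPernaLionsDataApproximation f₀ (fun n => fseq n 0))
    (hsol : ∀ n, IsDiPernaLionsApproximateSolution (δ n) (Bseq n) (fseq n))
    (hbd : UniformDiPernaLionsBounds δ Bseq fseq) (θ : ℕ → ℕ) {m : ℝ} (hm : 0 < m)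
    {χ : E → ℝ} (hχm : Measurable χ) (hχ1 : ∀ v, |χ v| ≤ 1) {T : ℝ}
    {G : ℝ × E × E → ℝ} (hGi : Integrable G (slabMeasure E T))
    (hGw : TendstoWeaklyL1 (fun k (z : ℝ × E × E) => χ z.2.2 * expTrunc m (fseq (θ k) z.1 z.2.1 z.2.2))
      G (slabMeasure E T))
    {ψ : ℝ × E × E → ℝ} (hψm : Measurable ψ) {M : ℝ} (hψ : ∀ z, |ψ z| ≤ M) :
    Tendsto (fun k => ∫ p, |velocityIntegral ψ
        (fun z : ℝ × E × E => χ z.2.2 * expTrunc m (fseq (θ k) z.1 z.2.1 z.2.2)) p -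
      velocityIntegral ψ G p| ∂(baseSlabMeasure E T)) atTop (𝓝 0) := by
  haveI : SigmaFinite (baseSlabMeasure E T) := by rw [baseSlabMeasure_def]; infer_instance
  set gk : ℕ → ℝ × E × E → ℝ := fun k z => χ z.2.2 * expTrunc m (fseq (θ k) z.1 z.2.1 z.2.2) with hgk
  set hk : ℕ → ℝ × E × E → ℝ := fun k z => χ z.2.2 * (exp (-(fseq (θ k) z.1 z.2.1 z.2.2) / m) *
    truncatedCollisionOp (δ (θ k)) (Bseq (θ k)) (fseq (θ k) z.1 z.2.1) z.2.2) with hhk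
  -- equi-integrability and tightness on the slab; integrability
  obtain ⟨hUI, hUT⟩ := uniformIntegrable_unifTight_renormalised_slab hsol hbd (continuous_expTrunc m)
    (fun y hy => expTrunc_nonneg hm hy) (fun y _ => expTrunc_le_self hm y) hχm hχ1 θ T
  have hgi : ∀ k, Integrable (gk k) (slabMeasure E T) := fun k =>
    memLp_one_iff_integrable.1 (hUI.memLp k)
  -- the transport equation in `𝒟'` and local equi-integrability of its right-hand side
  have hβ : ∀ y, 0 < y → HasDerivAt (expTrunc m) (exp (-y / m)) y := fun y _ =>
    hasDerivAt_expTrunc hm.ne' y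
  have hβ'c : ContinuousOn (fun y : ℝ => exp (-y / m)) (Ioi 0) :=
    (by fun_prop : Continuous fun y : ℝ => exp (-y / m)).continuousOn
  have hβ' : ∀ y, 0 ≤ y → |exp (-y / m)| * (1 + y) ≤ max m 1 := fun y hy => by
    rw [abs_of_pos (exp_pos _)]; exact exp_neg_div_mul_one_add_le hm hy
  have htr : ∀ k, HasDistribTransportOn (Ioo 0 T) (gk k) (hk k) := by
    intro k
    obtain ⟨Cb, hCb⟩ := hker.bounded (θ k)
    exact (hsol (θ k)).hasDistribTransportOn_renormalised (hker.isDiPernaLionsKernel (θ k)) hCb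
      (hδ (θ k)).le hβ hβ'c hχm hχ1 T
  have hloc : ∀ K ⊆ Ioo 0 T ×ˢ univ, IsCompact K →
      UniformIntegrable hk 1 ((volume : Measure (ℝ × E × E)).restrict K) := fun K hKS hKc =>
    uniformIntegrable_renormalised_rhs_compact hB hf₀ hδ hanti hlim hker hdata hsol hbd hβ'c hβ' hχm
      hχ1 θ hKc hKS
  -- velocity averaging: relative compactness of the velocity averages
  have hrc := h9 (T := T) (g := gk) (h := hk) (ψ := fun _ => ψ) (ψlim := ψ) hUI hUT htr hloc
    (fun n => hψm.aestronglyMeasurable) ⟨M, fun n => ae_of_all _ hψ⟩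
    (ae_of_all _ fun z => tendsto_const_nhds)
  -- the weak limit of the velocity averages is `∫ G ψ dξ`
  have hψb : ∀ᵐ z ∂(slabMeasure E T), |ψ z| ≤ M := ae_of_all _ hψ
  have hψb' : ∀ᵐ z ∂(slabMeasure E T), ‖ψ z‖ ≤ M := ae_of_all _ fun z => by
    rw [Real.norm_eq_abs]; exact hψ z
  have hvw : TendstoWeaklyL1 (fun k => velocityIntegral ψ (gk k)) (velocityIntegral ψ G)
      (baseSlabMeasure E T) :=
    tendstoWeaklyL1_velocityIntegral (fun k => (hgi k).mul_bdd hψm.aestronglyMeasurable hψb')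
      (hGi.mul_bdd hψm.aestronglyMeasurable hψb') (hGw.mul_fixed hψm.aestronglyMeasurable hψb)
  -- integrability of the velocity averages
  have hIk : ∀ k, Integrable (velocityIntegral ψ (gk k)) (baseSlabMeasure E T) := fun k =>
    (integrable_integral_velocity ((hgi k).mul_bdd hψm.aestronglyMeasurable hψb')).1
  have hIG : Integrable (velocityIntegral ψ G) (baseSlabMeasure E T) :=
    (integrable_integral_velocity (hGi.mul_bdd hψm.aestronglyMeasurable hψb')).1
  exact tendsto_integral_abs_sub_of_relativelyCompact_of_tendstoWeaklyL1 hIk hIG hvw hrc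

end Literature.MathematicalPhysics.KineticTheory
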